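import Summits.ValiantsHypothesis.ValiantsHypothesis.Theorems.DepthWindowDualityAtoms
import HarnessLib

/-!
# Route `DepthWindow`, g17 — duality halving III: one monomial per gate, the atom support

Third of five files proving `DualityHalving` (`Theorems/DepthWindowDualityHalvingProof.lean`).
§5 `Monomials`: in the symbolic circuit `symC d D L`, an operand of level `≤ L` is a monomial
(a constant, or an atom variable), so a nonconstant PRODUCT gate of level `L + 1` reads ONE monomial
`prodMon i` over the atoms (`exists_symC_gateVal_eq_monomial`), of degree `≤ d` when `d` bounds the
degrees of nonzero truncated values (`degree_prodMon_le`).  The ATOM SUPPORT `atomSupport d D` —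
`0`, the degree-one monomials, and one `prodMon` per gate — has at most `2 · D.size + |σ| + 1`
elements (`card_atomSupport_le`: the sparsity of the bottom layer, GKKS Lemma 4.4 with `s₁ ≤ #gates`),
every gate of level `≤ L + 1` has symbolic value supported on it (`support_symC_gateVal_subset`; sum
gates are linear combinations of operands of level `≤ L + 1`), and a polynomial supported on it has
degree `≤ d` (`totalDegree_le_of_support_subset`).
[cite: GuptaKamathKayalSaptharishi2016, §4, Lemma 4.4] [cite: Burgisser2000, Def. 2.1]
-/

-- layout Summits/ValiantsHypothesis/ValiantsHypothesis forces the duplicated namespace component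
set_option linter.dupNamespace false

namespace Summit.ValiantsHypothesis.ValiantsHypothesis.Theorems.DepthWindow

open MvPolynomial Literature.Computability.AlgebraicComplexity ArithCircuit
open Literature.Computability.AlgebraicComplexity.DepthReduction
open Literature.Computability.AlgebraicComplexity.DepthThreeChasm

section Monomials

variable {σ : Type*} (d : ℕ) (D : ArithCircuit ℂ σ)

/-! ### A product gate of level `L + 1` reads one monomial over the atoms -/

/-- The atom monomial of an operand of gate `i` (`0` for non-X-type operands).
[cite: GuptaKamathKayalSaptharishi2016, §4] -/
noncomputable def opMon (i : ℕ) : Operand ℂ σ → (Fin D.size ⊕ σ →₀ ℕ)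
  | .var t => Finsupp.single (Sum.inr t) 1
  | .const _ => 0
  | .gate j => if h : j < D.size then
      (if isX d D i (.gate j) = true then Finsupp.single (Sum.inl ⟨j, h⟩) 1 else 0) else 0

/-- The atom monomial of a product gate with operands `us`. -/
noncomputable def monOf (i : ℕ) (us : List (Operand ℂ σ)) : Fin D.size ⊕ σ →₀ ℕ :=
  (us.map (opMon d D i)).sum

/-- `monOf` of no operands. -/
theorem monOf_nil (i : ℕ) : monOf d D i [] = 0 := by simp [monOf]

/-- `monOf` of a cons. -/
theorem monOf_cons (i : ℕ) (u : Operand ℂ σ) (us : List (Operand ℂ σ)) :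
    monOf d D i (u :: us) = opMon d D i u + monOf d D i us := by simp [monOf]

/-- The degree of the atom monomial of an operand: `1` for X-type operands, else `0`. -/
theorem degree_opMon (i : ℕ) : ∀ u : Operand ℂ σ,
    (opMon d D i u).degree = if isX d D i u = true then 1 else 0
  | .var t => by simp [opMon, isX]
  | .const c => by simp [opMon, isX]
  | .gate j => by
      by_cases hj : j < D.size
      · simp only [opMon, dif_pos hj]
        split_ifs <;> simp
      · have hx : isX d D i (.gate j) = false := by
          have h0 : (tv d D j).totalDegree = 0 := by
            rw [tv_of_size_le d D (not_lt.1 hj), totalDegree_zero]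
          simp [isX, h0]
        simp [opMon, dif_neg hj, hx]

/-- **The degree of the atom monomial is the number of X-type operands.** -/
theorem degree_monOf (i : ℕ) (us : List (Operand ℂ σ)) :
    (monOf d D i us).degree = (us.filter (isX d D i)).length := by
  induction us with
  | nil => simp [monOf_nil]
  | cons u us ih =>
      rw [monOf_cons, map_add, ih, degree_opMon, List.filter_cons]
      split_ifs with hx <;> simp [Nat.add_comm]

variable {D} in
/-- **At most `d`**: the atom monomial of a product gate with nonconstant truncated value has
degree `≤ d`. [cite: GuptaKamathKayalSaptharishi2016, §4] -/
theorem degree_monOf_le (h : ∀ g ∈ gateValues D.gates, ∃ e : ℕ, g.IsHomogeneous e) {i : ℕ}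
    {us : List (Operand ℂ σ)} (hg : D.gates[i]? = some (.prod us))
    (hk : (tv d D i).totalDegree ≠ 0) : (monOf d D i us).degree ≤ d := by
  rw [degree_monOf]
  exact_mod_cast length_filter_isX_le d h hg hk

/-- Each symbolic operand of a gate whose operands have level `≤ L` is a monomial in the atoms. -/
theorem exists_symC_opVal_eq_monomial (L i : ℕ) :
    ∀ u : Operand ℂ σ, D.opPD i u ≤ L →
      ∃ c : ℂ, (symC d D L).opVal i (u.rename Sum.inr) = monomial (opMon d D i u) c
  | .var t, _ => ⟨1, rfl⟩
  | .const c, _ => ⟨c, by rw [Operand.rename, opVal_const, C_apply]; rfl⟩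
  | .gate j, hL => by
      rw [Operand.rename, opVal_gate]
      by_cases hj : j < i
      · rw [if_pos hj]
        rw [opPD_gate, if_pos hj] at hL
        by_cases hk : (tv d D j).totalDegree = 0
        · have hx : isX d D i (.gate j) = false := by simp [isX, hk]
          by_cases hjs : j < D.size
          · refine ⟨coeff 0 (tv d D j), ?_⟩
            rw [symC_gateVal_of_const d D L hjs hk, C_apply]
            simp [opMon, hx]
          · refine ⟨0, ?_⟩
            rw [gateVal_of_le _ (by rw [size_symC]; exact not_lt.1 hjs), monomial_zero]
        · have hjs : j < D.size := lt_size_of_tv d D hk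
          have hx : isX d D i (.gate j) = true := (isX_gate_iff d D).2 ⟨hj, hk⟩
          refine ⟨1, ?_⟩
          rw [symC_gateVal_of_atom d D L hjs hk hL]
          simp only [opMon, dif_pos hjs, hx, if_true]
          rfl
      · rw [if_neg hj]
        exact ⟨0, by rw [monomial_zero]⟩

/-- A product of symbolic operands of level `≤ L` is a monomial with exponent `monOf`. -/
theorem exists_prod_symC_opVal_eq_monomial (L i : ℕ) :
    ∀ us : List (Operand ℂ σ), (∀ u ∈ us, D.opPD i u ≤ L) →
      ∃ c : ℂ, ((us.map (Operand.rename Sum.inr)).map ((symC d D L).opVal i)).prod =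
        monomial (monOf d D i us) c
  | [], _ => ⟨1, by simp [monOf_nil]⟩
  | u :: us, hus => by
      obtain ⟨c₁, h₁⟩ := exists_symC_opVal_eq_monomial d D L i u (hus u (by simp))
      obtain ⟨c₂, h₂⟩ := exists_prod_symC_opVal_eq_monomial L i us fun v hv => hus v (by simp [hv])
      refine ⟨c₁ * c₂, ?_⟩
      rw [List.map_cons, List.map_cons, List.prod_cons, h₁, h₂, monomial_mul, monOf_cons]

variable {D} in
/-- **A nonconstant product gate of level `L + 1` reads one monomial over the atoms.**
[cite: GuptaKamathKayalSaptharishi2016, §4] -/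
theorem exists_symC_gateVal_eq_monomial {L i : ℕ} {us : List (Operand ℂ σ)}
    (hg : D.gates[i]? = some (.prod us)) (hk : (tv d D i).totalDegree ≠ 0)
    (hL : ¬ D.gatePD i ≤ L) (hus : ∀ u ∈ us, D.opPD i u ≤ L) :
    ∃ c : ℂ, (symC d D L).gateVal i = monomial (monOf d D i us) c := by
  have hsym := symC_gates_of_high d D L hg hk hL
  rw [Gate.rename] at hsym
  rw [gateVal_of_prod _ hsym]
  exact exists_prod_symC_opVal_eq_monomial d D L i us hus

/-! ### The atom support -/

/-- The atom monomial of gate `i`: `monOf` for a nonconstant product gate, else `0`. -/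
noncomputable def prodMon (i : ℕ) : Fin D.size ⊕ σ →₀ ℕ :=
  if (tv d D i).totalDegree = 0 then 0 else
    match D.gates[i]? with
    | some (.prod us) => monOf d D i us
    | _ => 0

/-- `prodMon` of a nonconstant product gate is the `monOf` of its operands. -/
theorem prodMon_of_prod {i : ℕ} {us : List (Operand ℂ σ)} (hg : D.gates[i]? = some (.prod us))
    (hk : (tv d D i).totalDegree ≠ 0) : prodMon d D i = monOf d D i us := by
  rw [prodMon, if_neg hk, hg]

variable {D} in
/-- The atom monomial of a gate has degree `≤ d`. [cite: GuptaKamathKayalSaptharishi2016, Lemma 4.4] -/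
theorem degree_prodMon_le (h : ∀ g ∈ gateValues D.gates, ∃ e : ℕ, g.IsHomogeneous e) (i : ℕ) :
    (prodMon d D i).degree ≤ d := by
  rw [prodMon]
  split_ifs with hk
  · simp
  · rcases hgi : D.gates[i]? with _ | g
    · simp
    · cases g with
      | sum args => simp
      | prod us => exact degree_monOf_le d h hgi hk

variable [Fintype σ] [DecidableEq σ]

/-- **The atom support**: `0`, the atoms and variables, and one monomial per nonconstant product
gate — at most `2 · D.size + |σ| + 1` monomials. [cite: GuptaKamathKayalSaptharishi2016, Lemma 4.4] -/
noncomputable def atomSupport : Finset (Fin D.size ⊕ σ →₀ ℕ) :=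
  {0} ∪ Finset.univ.image (fun v : Fin D.size ⊕ σ => Finsupp.single v 1) ∪
    (Finset.range D.size).image (prodMon d D)

/-- **Sparsity of the bottom layer**: at most `2 s + |σ| + 1` atom monomials.
[cite: GuptaKamathKayalSaptharishi2016, Lemma 4.4] -/
theorem card_atomSupport_le : (atomSupport d D).card ≤ 2 * D.size + Fintype.card σ + 1 := by
  unfold atomSupport
  refine (Finset.card_union_le _ _).trans ?_
  have h1 := Finset.card_union_le ({0} : Finset (Fin D.size ⊕ σ →₀ ℕ))
    (Finset.univ.image (fun v : Fin D.size ⊕ σ => Finsupp.single v 1))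
  have h2 : (Finset.univ.image (fun v : Fin D.size ⊕ σ => Finsupp.single v 1)).card ≤
      D.size + Fintype.card σ :=
    Finset.card_image_le.trans (by simp [Fintype.card_sum])
  have h3 : ((Finset.range D.size).image (prodMon d D)).card ≤ D.size :=
    Finset.card_image_le.trans (by simp)
  rw [Finset.card_singleton] at h1
  omega

variable {D} in
/-- Every monomial of the atom support has degree `≤ d`. -/
theorem degree_le_of_mem_atomSupport (hd : 1 ≤ d)
    (h : ∀ g ∈ gateValues D.gates, ∃ e : ℕ, g.IsHomogeneous e) {s : Fin D.size ⊕ σ →₀ ℕ}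
    (hs : s ∈ atomSupport d D) : s.degree ≤ d := by
  simp only [atomSupport, Finset.mem_union, Finset.mem_singleton, Finset.mem_image,
    Finset.mem_univ, true_and, Finset.mem_range] at hs
  rcases hs with (rfl | ⟨v, rfl⟩) | ⟨i, -, rfl⟩
  · simp
  · simpa using hd
  · exact degree_prodMon_le d h i

/-- A polynomial supported on the atom support has degree `≤ d`. -/
theorem totalDegree_le_of_support_subset (hd : 1 ≤ d)
    (h : ∀ g ∈ gateValues D.gates, ∃ e : ℕ, g.IsHomogeneous e)
    {p : MvPolynomial (Fin D.size ⊕ σ) ℂ} (hp : p.support ⊆ atomSupport d D) :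
    p.totalDegree ≤ d := by
  rw [totalDegree]
  refine Finset.sup_le fun s hs => ?_
  have := degree_le_of_mem_atomSupport d hd h (hp hs)
  rwa [Finsupp.degree_apply] at this

/-- Degree-one monomials are atom monomials. -/
theorem single_mem_atomSupport (v : Fin D.size ⊕ σ) : Finsupp.single v 1 ∈ atomSupport d D := by
  simp [atomSupport]

/-- The constant monomial is an atom monomial. -/
theorem zero_mem_atomSupport : (0 : Fin D.size ⊕ σ →₀ ℕ) ∈ atomSupport d D := by
  simp [atomSupport]

/-- The atom monomial of a gate is an atom monomial. -/
theorem prodMon_mem_atomSupport {i : ℕ} (hi : i < D.size) : prodMon d D i ∈ atomSupport d D := by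
  simp only [atomSupport, Finset.mem_union, Finset.mem_image, Finset.mem_range]
  exact Or.inr ⟨i, hi, rfl⟩

variable {D} in
/-- **Support of the symbolic values**: every gate of level `≤ L + 1` has symbolic value
supported on the atom support. [cite: GuptaKamathKayalSaptharishi2016, Lemma 4.4] -/
theorem support_symC_gateVal_subset
    (L : ℕ) : ∀ i, D.gatePD i ≤ L + 1 → ((symC d D L).gateVal i).support ⊆ atomSupport d D := by
  intro i
  induction i using Nat.strong_induction_on with
  | _ i ih =>
  intro hLi
  have hop : ∀ u : Operand ℂ σ, D.opPD i u ≤ L + 1 →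
      ((symC d D L).opVal i (u.rename Sum.inr)).support ⊆ atomSupport d D := by
    intro u hu
    cases u with
    | var t =>
        rw [Operand.rename, opVal_var]
        exact support_monomial_subset.trans
          (Finset.singleton_subset_iff.2 (single_mem_atomSupport d D _))
    | const c =>
        rw [Operand.rename, opVal_const, C_apply]
        exact support_monomial_subset.trans
          (Finset.singleton_subset_iff.2 (zero_mem_atomSupport d D))
    | gate j =>
        rw [Operand.rename, opVal_gate]
        rw [opPD_gate] at hu
        split_ifs at hu ⊢ with hj
        · exact ih j hj hu
        · simp
  by_cases hi : i < D.size
  swap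
  · rw [gateVal_of_le _ (by rw [size_symC]; exact not_lt.1 hi)]
    simp
  by_cases hk : (tv d D i).totalDegree = 0
  · rw [symC_gateVal_of_const d D L hi hk, C_apply]
    exact support_monomial_subset.trans (Finset.singleton_subset_iff.2 (zero_mem_atomSupport d D))
  by_cases hL : D.gatePD i ≤ L
  · rw [symC_gateVal_of_atom d D L hi hk hL]
    exact support_monomial_subset.trans
      (Finset.singleton_subset_iff.2 (single_mem_atomSupport d D _))
  obtain ⟨g, hg⟩ : ∃ g, D.gates[i]? = some g := ⟨D.gates[i], List.getElem?_eq_getElem hi⟩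
  cases g with
  | prod us =>
      have hus : ∀ u ∈ us, D.opPD i u ≤ L := fun u hu => by
        have := opPD_succ_le_gatePD_of_prod D hg hu
        omega
      obtain ⟨c, hc⟩ := exists_symC_gateVal_eq_monomial d hg hk hL hus
      rw [hc, ← prodMon_of_prod d D hg hk]
      exact support_monomial_subset.trans
        (Finset.singleton_subset_iff.2 (prodMon_mem_atomSupport d D hi))
  | sum args =>
      have hsym := symC_gates_of_high d D L hg hk hL
      rw [Gate.rename] at hsym
      rw [gateVal_of_sum _ hsym, List.map_map]
      have hargs : ∀ a ∈ args, D.opPD i a.2 ≤ L + 1 := fun a ha =>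
        (opPD_le_gatePD_of_sum D hg ha).trans hLi
      clear hsym hg
      induction args with
      | nil => simp
      | cons a args iha =>
          rw [List.map_cons, List.sum_cons]
          refine support_add.trans (Finset.union_subset ?_ (iha fun b hb => hargs b (by simp [hb])))
          simp only [Function.comp_apply]
          exact support_smul.trans (hop a.2 (hargs a (by simp)))

end Monomials

end Summit.ValiantsHypothesis.ValiantsHypothesis.Theorems.DepthWindow
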